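import Literature.Topology.FourManifolds.CerfBirthDeathCurve
import Literature.Topology.FourManifolds.CerfCrossing
import HarnessLib

/-!
# The critical set of a slice of a generic path: finiteness and local structure in families
# (Cerf 1968, Ch. II §2, Prop. 4: "les points de rebroussement et les points doubles varient
# continûment"; §3, Prop. 7)

Topic `Literature/Topology/FourManifolds` (programme of the fact
`Literature.Topology.FourManifolds.cerf_pi0DiffDisc_relBoundary_three`, brick C1, structure layer).
For a smooth two-parameter family `F u (λ, x)` of functions on the plane (a one-parameter family
`u` of paths `λ`, the format of `CerfBirthDeathCurve` and `CerfCrossing`), a compact set `K` of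
the plane and a parameter value `(u, λ) = (0, λ₀)`, this file derives from the POINTWISE
genericity conditions of Cerf's Déf. 1 at `(0, λ₀)` the local structure of the critical sets of
the nearby slices `x ↦ F u (λ, x)` inside `K`:

* `eventually_pos_of_deriv_two_pos`, `eventually_eq_zero_of_deriv_two_ne_zero` — a real
  function with `φ(0) = φ′(0) = 0 ≠ φ″(0)` has an isolated zero at `0`;
* `eventually_eq_of_nondegenerate`, `eventually_eq_of_birthDeath` — nondegenerate critical
  points and generic birth–death points of a slice are ISOLATED critical points of that slice
  (the latter through the indicatrix of `CerfBirthDeathCurve.exists_birthDeath_chart`: on the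
  slice `λ = λ₀` the indicatrix parameter `s` satisfies `T(0, s) = 0`, and `T(0, ·)` has an
  isolated zero since `∂ₛT = 0 ≠ ∂ₛ∂ₛT` at `0`, `CerfBirthDeathCurve.ddT_mul_sum_eq`);
* `finite_of_isolated` — a closed subset of a compact set all of whose points are isolated is
  finite; hence `finite_criticalSet`: **the critical points in `K` of a slice all of whose
  critical points in `K` are nondegenerate or generic birth–death points form a finite set**;
* `eventually_forall_near_critical` — **no new critical points**: for `(u, λ)` near `(0, λ₀)`
  every critical point in `K` of the slice is close to a critical point of the slice `(0, λ₀)`;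
* `exists_local_continuations` — **local structure, nondegenerate case**: if all critical points
  of the slice `(0, λ₀)` in `K` are nondegenerate, they are finitely many, each continues to a
  smooth function `ξₓ(u, λ)` of the parameters (`CerfCrossing.exists_criticalPoint_continuation`),
  and for `(u, λ)` near `(0, λ₀)` the critical points of the slice in `K` are exactly the
  (pairwise distinct, nondegenerate) points `ξₓ(u, λ)`.

## References
* [CerfDiffeoSphere1968] J. Cerf, *Sur les difféomorphismes de la sphère de dimension trois
  (Γ₄ = 0)*, LNM 53 (1968), Ch. II §2, 2°–3°, Prop. 4; §3, Prop. 7.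
-/

noncomputable section

open Set Function Filter Module Metric
open scoped ContDiff Topology BigOperators

namespace Literature.Topology.FourManifolds

namespace CerfPath

open Literature.Analysis.Calculus Literature.Analysis.Calculus.ParametricTransversality

/-- Local notation: the model plane. -/
local notation "𝔼²" => EuclideanSpace ℝ (Fin 2)

/-! ### A real function with `φ(0) = φ′(0) = 0 ≠ φ″(0)` has an isolated zero -/

/-- If `φ` is `C²` near `0`, `φ 0 = 0`, `φ′ 0 = 0` and `φ″ 0 > 0`, then `0` is a strict local
minimum: `φ s > 0` for small `s ≠ 0` (`φ′` is strictly increasing near `0`, so has the sign of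
`s`). [folklore] -/
theorem eventually_pos_of_deriv_two_pos {φ : ℝ → ℝ} (hφ : ∀ᶠ s in 𝓝 (0 : ℝ), ContDiffAt ℝ 2 φ s)
    (h0 : φ 0 = 0) (h1 : deriv φ 0 = 0) (h2 : 0 < deriv (deriv φ) 0) :
    ∀ᶠ s in 𝓝 (0 : ℝ), s ≠ 0 → 0 < φ s := by
  have hφ0 : ContDiffAt ℝ 2 φ 0 := hφ.self_of_nhds
  have hd1 : ∀ᶠ s in 𝓝 (0 : ℝ), DifferentiableAt ℝ φ s :=
    hφ.mono fun s hs => hs.differentiableAt (by norm_num)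
  have hderiv_eq : (fun s => fderiv ℝ φ s 1) = deriv φ := by funext s; simp
  have hd2 : ∀ᶠ s in 𝓝 (0 : ℝ), DifferentiableAt ℝ (deriv φ) s := by
    filter_upwards [hφ] with s hs
    have h' : ContDiffAt ℝ 1 (fun s => fderiv ℝ φ s 1) s :=
      (hs.fderiv_right (m := 1) (by norm_num)).clm_apply contDiffAt_const
    rw [hderiv_eq] at h'
    exact h'.differentiableAt (by norm_num)
  have hc2 : ContinuousAt (deriv (deriv φ)) 0 := by
    have h' : ContDiffAt ℝ 1 (fun s => fderiv ℝ φ s 1) 0 :=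
      (hφ0.fderiv_right (m := 1) (by norm_num)).clm_apply contDiffAt_const
    rw [hderiv_eq] at h'
    have h3 : ContDiffAt ℝ 0 (fun s => fderiv ℝ (deriv φ) s 1) 0 :=
      (h'.fderiv_right (m := 0) (by norm_num)).clm_apply contDiffAt_const
    have heq' : (fun s => fderiv ℝ (deriv φ) s 1) = deriv (deriv φ) := by funext s; simp
    rw [heq'] at h3
    exact h3.continuousAt
  have hpos : ∀ᶠ s in 𝓝 (0 : ℝ), 0 < deriv (deriv φ) s := hc2.eventually (eventually_gt_nhds h2)
  obtain ⟨δ, hδ, hball⟩ := Metric.eventually_nhds_iff_ball.1 (hd1.and (hd2.and hpos))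
  have hI : ∀ s ∈ Ioo (-δ) δ, DifferentiableAt ℝ φ s ∧ DifferentiableAt ℝ (deriv φ) s ∧
      0 < deriv (deriv φ) s := fun s hs => hball s (by
    rw [mem_ball, Real.dist_eq, sub_zero]; exact abs_lt.2 hs)
  -- `φ′` is strictly increasing on `(-δ, δ)`, hence has the sign of `s`
  have hmono : StrictMonoOn (deriv φ) (Ioo (-δ) δ) := by
    refine strictMonoOn_of_deriv_pos (convex_Ioo _ _)
      (fun s hs => (hI s hs).2.1.continuousAt.continuousWithinAt) fun s hs => ?_
    rw [interior_Ioo] at hs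
    exact (hI s hs).2.2
  have h0I : (0 : ℝ) ∈ Ioo (-δ) δ := ⟨by linarith, hδ⟩
  have hdpos : ∀ s ∈ Ioo 0 δ, 0 < deriv φ s := fun s hs => by
    have h := hmono h0I ⟨by linarith [hs.1], hs.2⟩ hs.1
    rwa [h1] at h
  have hdneg : ∀ s ∈ Ioo (-δ) 0, deriv φ s < 0 := fun s hs => by
    have h := hmono ⟨hs.1, by linarith [hs.2]⟩ h0I hs.2
    rwa [h1] at h
  have hcont : ContinuousOn φ (Ioo (-δ) δ) := fun s hs =>
    (hI s hs).1.continuousAt.continuousWithinAt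
  -- `φ` is strictly increasing on `[0, δ)` and strictly decreasing on `(-δ, 0]`
  have hup : StrictMonoOn φ (Ico 0 δ) := by
    refine strictMonoOn_of_deriv_pos (convex_Ico _ _)
      (hcont.mono (Ico_subset_Ioo_left (by linarith))) fun s hs => ?_
    rw [interior_Ico] at hs
    exact hdpos s hs
  have hdown : StrictAntiOn φ (Ioc (-δ) 0) := by
    refine strictAntiOn_of_deriv_neg (convex_Ioc _ _)
      (hcont.mono (Ioc_subset_Ioo_right hδ)) fun s hs => ?_
    rw [interior_Ioc] at hs
    exact hdneg s hs
  rw [Metric.eventually_nhds_iff_ball]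
  refine ⟨δ, hδ, fun s hs hs0 => ?_⟩
  rw [mem_ball, Real.dist_eq, sub_zero, abs_lt] at hs
  rcases lt_or_gt_of_ne hs0 with hneg | hpos'
  · have h := hdown ⟨hs.1, hneg.le⟩ ⟨by linarith, le_rfl⟩ hneg
    rwa [h0] at h
  · have h := hup ⟨le_rfl, hδ⟩ ⟨hpos'.le, hs.2⟩ hpos'
    rwa [h0] at h

/-- **A zero with vanishing first and non-vanishing second derivative is isolated**: if `φ` is
`C²` near `0` with `φ 0 = 0`, `φ′ 0 = 0`, `φ″ 0 ≠ 0`, then `φ s ≠ 0` for small `s ≠ 0`.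
[folklore] -/
theorem eventually_eq_zero_of_deriv_two_ne_zero {φ : ℝ → ℝ}
    (hφ : ∀ᶠ s in 𝓝 (0 : ℝ), ContDiffAt ℝ 2 φ s) (h0 : φ 0 = 0) (h1 : deriv φ 0 = 0)
    (h2 : deriv (deriv φ) 0 ≠ 0) : ∀ᶠ s in 𝓝 (0 : ℝ), φ s = 0 → s = 0 := by
  rcases lt_or_gt_of_ne h2 with hneg | hpos
  · -- apply the positive case to `-φ`
    have hφ' : ∀ᶠ s in 𝓝 (0 : ℝ), ContDiffAt ℝ 2 (fun s => -φ s) s := hφ.mono fun s hs => hs.neg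
    have hd : deriv (fun s => -φ s) = fun s => -deriv φ s := by funext s; exact deriv.neg
    have h1' : deriv (fun s => -φ s) 0 = 0 := by rw [hd]; simp [h1]
    have h2' : 0 < deriv (deriv fun s => -φ s) 0 := by
      rw [hd, show deriv (fun s => -deriv φ s) 0 = -deriv (deriv φ) 0 from deriv.neg]
      linarith
    filter_upwards [eventually_pos_of_deriv_two_pos hφ' (by simp [h0]) h1' h2'] with s hs hφs
    by_contra hs0
    have h := hs hs0
    simp [hφs] at h
  · filter_upwards [eventually_pos_of_deriv_two_pos hφ h0 h1 hpos] with s hs hφs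
    by_contra hs0
    exact (hs hs0).ne' hφs

/-! ### Isolated critical points of a slice -/

variable {F : ℝ → ℝ × 𝔼² → ℝ}

/-- **A nondegenerate critical point of a slice is an isolated critical point of that slice**
(uniqueness clause of the implicit-function continuation). [cite: CerfDiffeoSphere1968, Ch. II §2, Prop. 4] -/
theorem eventually_eq_of_nondegenerate (hF : ContDiff ℝ ∞ fun p : ℝ × (ℝ × 𝔼²) => F p.1 p.2)
    {t₀ : ℝ} {x₀ : 𝔼²} (hcrit : d1 (F 0) (t₀, x₀) = 0) (hδ : hessDet (F 0) (t₀, x₀) ≠ 0) :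
    ∀ᶠ x in 𝓝 x₀, d1 (F 0) (t₀, x) = 0 → x = x₀ := by
  obtain ⟨ξ, hξ0, -, -, huniq⟩ := exists_criticalPoint_continuation hF hcrit hδ
  have hc : Continuous fun x : 𝔼² => ((x, ((0 : ℝ), t₀)) : 𝔼² × (ℝ × ℝ)) :=
    continuous_id.prodMk continuous_const
  have h := (hc.tendsto x₀).eventually huniq
  filter_upwards [h] with x hx hcx
  rw [hx hcx, hξ0]

/-- **A generic birth–death point of a slice is an isolated critical point of that slice.**  By
the uniqueness clause of the birth–death chart every nearby critical point of the slice
`λ = λ₀` is a point `indPt z₀ k g (0, s)` of the indicatrix with `T(0, s) = 0`; but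
`T(0, 0) = ∂ₛT(0, 0) = 0` (horizontal tangent) and `∂ₛ∂ₛT(0, 0) ≠ 0` (the cusp), so `s = 0`.
[cite: CerfDiffeoSphere1968, Ch. II §2, 2°–3°] -/
theorem eventually_eq_of_birthDeath (hF : ContDiff ℝ ∞ fun p : ℝ × (ℝ × 𝔼²) => F p.1 p.2)
    {z₀ : ℝ × 𝔼²} (hcrit : d1 (F 0) z₀ = 0) (hdeg : hessDet (F 0) z₀ = 0)
    (hjet : jet2 (F 0) z₀ ≠ 0)
    (hcorr : Surjective (fderiv ℝ (fun z => (d1 (F 0) z, hessDet (F 0) z)) z₀)) :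
    ∀ᶠ x in 𝓝 z₀.2, d1 (F 0) (z₀.1, x) = 0 → x = z₀.2 := by
  obtain ⟨k, g, ε, hk1, hε, hg0, hk0, hk1', hg3, hgcrit, hds, hv, hC, huniq, -⟩ :=
    exists_birthDeath_chart hF hcrit hdeg hjet hcorr
  -- `T(0, s) = (g (0, s)).1` has an isolated zero at `s = 0`
  have hball : ∀ s : ℝ, |s| < ε → ((0 : ℝ), s) ∈ ball (0 : ℝ × ℝ) ε := fun s hs => by
    rw [mem_ball, Prod.dist_eq]
    simp only [Prod.fst_zero, Prod.snd_zero, dist_zero_right, norm_zero, Real.norm_eq_abs]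
    exact max_lt hε hs
  have hnear : ∀ᶠ s in 𝓝 (0 : ℝ), |s| < ε := by
    have : ∀ᶠ s in 𝓝 (0 : ℝ), s ∈ ball (0 : ℝ) ε := ball_mem_nhds 0 hε
    filter_upwards [this] with s hs
    rwa [mem_ball, Real.dist_eq, sub_zero] at hs
  -- derivative of `T(0, ·)` along `s`
  have hderT : ∀ s : ℝ, |s| < ε →
      HasDerivAt (fun s => (g (0, s)).1) ((fderiv ℝ g (0, s) (0, 1)).1) s := fun s hs => by
    have hgd : HasFDerivAt g (fderiv ℝ g (0, s)) ((0 : ℝ), s) :=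
      ((hg3 _ (hball s hs)).differentiableAt (by norm_num)).hasFDerivAt
    have hsl := hasDerivAt_sliceS (y := ((0 : ℝ), s)) hgd
    have hfst : HasFDerivAt (fun q : ℝ × ℝ => q.1) (ContinuousLinearMap.fst ℝ ℝ ℝ) (g (0, s)) :=
      hasFDerivAt_fst
    exact hfst.comp_hasDerivAt s hsl
  have hderiv_eq : ∀ᶠ s in 𝓝 (0 : ℝ), deriv (fun s => (g (0, s)).1) s =
      (fderiv ℝ g (0, s) (0, 1)).1 := hnear.mono fun s hs => (hderT s hs).deriv
  have hT : ∀ᶠ s in 𝓝 (0 : ℝ), (g (0, s)).1 = 0 → s = 0 := by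
    refine eventually_eq_zero_of_deriv_two_ne_zero ?_ ?_ ?_ ?_
    · filter_upwards [hnear] with s hs
      have hin : ContDiffAt ℝ 3 (fun s : ℝ => ((0 : ℝ), s)) s :=
        contDiffAt_const.prodMk contDiffAt_id
      have h := (contDiffAt_fst.comp _ (hg3 _ (hball s hs))).comp s hin
      exact h.of_le (by norm_num)
    · have : g ((0 : ℝ), (0 : ℝ)) = 0 := hg0
      simp [this]
    · rw [(hderT 0 (by simpa using hε)).deriv]
      have : fderiv ℝ g ((0 : ℝ), (0 : ℝ)) (0, 1) = 0 := hds
      simp [this]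
    · rw [Filter.EventuallyEq.deriv_eq hderiv_eq]
      have hgd2 : HasFDerivAt (fun y => (fderiv ℝ g y (0, 1)).1)
          (fderiv ℝ (fun y => (fderiv ℝ g y (0, 1)).1) (0, 0)) ((0 : ℝ), (0 : ℝ)) :=
        ((contDiffAt_dT (hg3 _ (by simpa using hε))).differentiableAt (by norm_num)).hasFDerivAt
      have hsl := hasDerivAt_sliceS (y := ((0 : ℝ), (0 : ℝ))) hgd2
      rw [hsl.deriv]
      intro h0
      have hdd := ddT_mul_sum_eq hF isOpen_ball (mem_ball_self hε) hg3 hgcrit hg0 hds hk0 hk1'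
      have h0' : fderiv ℝ (fun y => (fderiv ℝ g y (0, 1)).1) 0 (0, 1) = 0 := h0
      rw [h0', zero_mul] at hdd
      exact hC (neg_eq_zero.1 hdd.symm)
  -- conclusion through the uniqueness clause of the chart
  obtain ⟨ρ, hρ, hρT⟩ := Metric.eventually_nhds_iff.1 hT
  rw [Metric.eventually_nhds_iff]
  refine ⟨min ε ρ, lt_min hε hρ, fun x hx hcx => ?_⟩
  have hxε : dist x z₀.2 < ε := hx.trans_le (min_le_left _ _)
  have hdz : dist (z₀.1, x) z₀ < ε := by
    rw [Prod.dist_eq]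
    exact max_lt (by simp [hε]) hxε
  obtain ⟨-, hz⟩ := huniq 0 (z₀.1, x) (by simpa using hε) hdz hcx
  have hs_small : |sCoord k (x - z₀.2)| < ρ :=
    (abs_sCoord_le hk1 _).trans_lt (by
      rw [← dist_eq_norm]; exact hx.trans_le (min_le_right _ _))
  have hTs : (g (0, sCoord k (x - z₀.2))).1 = 0 := by
    have h := congrArg Prod.fst hz
    rw [indPt_apply] at h
    simp only [Prod.fst_add] at h
    linarith
  have hs0 : sCoord k (x - z₀.2) = 0 :=
    hρT (by rwa [Real.dist_eq, sub_zero]) hTs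
  have h2 := congrArg Prod.snd hz
  rw [indPt_apply, hs0] at h2
  have hg00 : g ((0 : ℝ), (0 : ℝ)) = 0 := hg0
  simp only [Prod.snd_add, hg00, Prod.snd_zero, zero_smul, add_zero] at h2
  simpa using h2

/-! ### Finiteness of the critical set of a slice -/

/-- A subset of a compact set which is closed and all of whose points are isolated in it is
finite. [folklore] -/
theorem finite_of_isolated {X : Type*} [MetricSpace X] {Z K : Set X} (hK : IsCompact K)
    (hZK : Z ⊆ K) (hZ : IsClosed Z) (hiso : ∀ x ∈ Z, ∀ᶠ y in 𝓝 x, y ∈ Z → y = x) :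
    Z.Finite := by
  by_contra hinf
  obtain ⟨x, -, hacc⟩ := Set.Infinite.exists_accPt_of_subset_isCompact hinf hK hZK
  have hxZ : x ∈ Z := by
    rw [← hZ.closure_eq, mem_closure_iff_clusterPt]
    exact hacc.clusterPt
  rw [accPt_iff_frequently] at hacc
  obtain ⟨y, ⟨hne, hyZ⟩, hy⟩ := (hacc.and_eventually (hiso x hxZ)).exists
  exact hne (hy hyZ)

/-- **The critical set of a generic slice in a compact set is finite**: if every critical point
in `K` of the slice `x ↦ F 0 (λ₀, x)` is nondegenerate or a generic birth–death point, there
are finitely many of them. [cite: CerfDiffeoSphere1968, Ch. II §2, Déf. 1 and 2°] -/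
theorem finite_criticalSet (hF : ContDiff ℝ ∞ fun p : ℝ × (ℝ × 𝔼²) => F p.1 p.2) {K : Set 𝔼²}
    (hK : IsCompact K) (t₀ : ℝ)
    (hgen : ∀ x ∈ K, d1 (F 0) (t₀, x) = 0 → hessDet (F 0) (t₀, x) ≠ 0 ∨
      (jet2 (F 0) (t₀, x) ≠ 0 ∧
        Surjective (fderiv ℝ (fun z => (d1 (F 0) z, hessDet (F 0) z)) (t₀, x)))) :
    {x ∈ K | d1 (F 0) (t₀, x) = 0}.Finite := by
  have hF0 : ContDiff ℝ ∞ (F 0) := contDiff_member hF 0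
  have hin : Continuous fun x : 𝔼² => ((t₀, x) : ℝ × 𝔼²) := continuous_const.prodMk continuous_id
  have hcont : Continuous fun x : 𝔼² => d1 (F 0) (t₀, x) := by
    have h := (contDiff_d1_pi hF0).continuous.comp hin
    exact h
  refine finite_of_isolated hK (fun x hx => hx.1)
    (hK.isClosed.inter (isClosed_eq hcont continuous_const)) fun x hx => ?_
  by_cases hdeg : hessDet (F 0) (t₀, x) = 0
  · have h2 : jet2 (F 0) (t₀, x) ≠ 0 ∧
        Surjective (fderiv ℝ (fun z => (d1 (F 0) z, hessDet (F 0) z)) (t₀, x)) :=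
      (hgen x hx.1 hx.2).resolve_left (not_not.2 hdeg)
    filter_upwards [eventually_eq_of_birthDeath hF (z₀ := (t₀, x)) hx.2 hdeg h2.1 h2.2]
      with y hy hyZ
    exact hy hyZ.2
  · filter_upwards [eventually_eq_of_nondegenerate hF hx.2 hdeg] with y hy hyZ
    exact hy hyZ.2

/-! ### No new critical points near a parameter value -/

/-- **No new critical points**: for `(u, λ)` near `(0, λ₀)`, every critical point in the compact
set `K` of the slice `x ↦ F u (λ, x)` lies within `δ` of a critical point in `K` of the slice
`(0, λ₀)` (the slices have no critical points on the compact set of points of `K` at distance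
`≥ δ` from the critical set, uniformly for nearby parameters).
[cite: CerfDiffeoSphere1968, Ch. II §2, Prop. 4] -/
theorem eventually_forall_near_critical (hF : ContDiff ℝ ∞ fun p : ℝ × (ℝ × 𝔼²) => F p.1 p.2)
    {K : Set 𝔼²} (hK : IsCompact K) (t₀ : ℝ) {δ : ℝ} (hδ : 0 < δ) :
    ∀ᶠ y in 𝓝 (((0 : ℝ), t₀) : ℝ × ℝ), ∀ x ∈ K, d1 (F y.1) (y.2, x) = 0 →
      ∃ x' ∈ K, d1 (F 0) (t₀, x') = 0 ∧ dist x x' < δ := by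
  -- the compact set of points of `K` far from the critical set of the slice `(0, λ₀)`
  obtain ⟨s, hs⟩ : ∃ s : Set 𝔼², s = {x' | x' ∈ K ∧ d1 (F 0) (t₀, x') = 0} := ⟨_, rfl⟩
  obtain ⟨K', hK'⟩ : ∃ K' : Set 𝔼², K' = K ∩ ⋂ x' ∈ s, {x | δ ≤ dist x x'} := ⟨_, rfl⟩
  have hK'c : IsClosed K' := by
    rw [hK']
    exact hK.isClosed.inter (isClosed_biInter fun x' _ =>
      isClosed_le continuous_const (continuous_id.dist continuous_const))
  have hK'K : K' ⊆ K := by rw [hK']; exact inter_subset_left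
  have hK'cpt : IsCompact K' := hK.of_isClosed_subset hK'c hK'K
  have hne : ∀ x ∈ K', d1 (F 0) (t₀, x) ≠ 0 := fun x hx h => by
    rw [hK'] at hx
    have hxs : x ∈ s := by rw [hs]; exact ⟨hx.1, h⟩
    have h' : x ∈ {x'' : 𝔼² | δ ≤ dist x'' x} := (mem_iInter₂.1 hx.2) x hxs
    rw [mem_setOf_eq, dist_self] at h'
    linarith
  have hcont : Continuous fun q : (ℝ × ℝ) × 𝔼² => d1 (F q.1.1) (q.1.2, q.2) := by
    have h1 : Continuous fun q : (ℝ × ℝ) × 𝔼² => ((q.1.1, (q.1.2, q.2)) : ℝ × (ℝ × 𝔼²)) :=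
      (continuous_fst.comp continuous_fst).prodMk
        ((continuous_snd.comp continuous_fst).prodMk continuous_snd)
    have h2 := (contDiff_d1_member_pi hF).continuous.comp h1
    exact h2
  have hP : ∀ x ∈ K', ∀ᶠ q in 𝓝 ((((0 : ℝ), t₀) : ℝ × ℝ), x),
      d1 (F q.1.1) (q.1.2, q.2) ≠ 0 := fun x hx =>
    (hcont.continuousAt (x := (((0 : ℝ), t₀), x))).eventually_ne (hne x hx)
  filter_upwards [hK'cpt.eventually_forall_of_forall_eventually
    (P := fun y x => d1 (F y.1) (y.2, x) ≠ 0) hP] with y hy x hxK hcx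
  by_contra hcon
  push Not at hcon
  refine hy x ?_ hcx
  rw [hK']
  refine ⟨hxK, mem_iInter₂.2 fun x' hx' => ?_⟩
  rw [hs] at hx'
  exact hcon x' hx'.1 hx'.2

/-! ### Local structure: the nondegenerate case -/

/-- **Continuations of finitely many nondegenerate critical points, with accounting of all
critical points.**  Let `S` be a finite set of NONDEGENERATE critical points in the compact set
`K` of the slice `x ↦ F 0 (λ₀, x)`.  Then each `x ∈ S`
continues to a function `ξ x (u, λ)`, smooth at `(0, λ₀)` with `ξ x (0, λ₀) = x`; for `(u, λ)`
near `(0, λ₀)` the `ξ x (u, λ)` are nondegenerate critical points of the slice, pairwise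
distinct, each the unique critical point near `x` (uniformly in the parameters); and, for every
`ρ > 0`, eventually every critical point of the slice in `K` is one of them or lies within `ρ`
of a critical point of the slice `(0, λ₀)` outside `S`.
[cite: CerfDiffeoSphere1968, Ch. II §2, Prop. 4] -/
theorem exists_continuations_core (hF : ContDiff ℝ ∞ fun p : ℝ × (ℝ × 𝔼²) => F p.1 p.2)
    {K : Set 𝔼²} (hK : IsCompact K) (t₀ : ℝ) (S : Finset 𝔼²)
    (hS : ∀ x ∈ S, x ∈ K ∧ d1 (F 0) (t₀, x) = 0 ∧ hessDet (F 0) (t₀, x) ≠ 0) :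
    ∃ ξ : 𝔼² → ℝ × ℝ → 𝔼²,
      (∀ x ∈ S, ξ x (0, t₀) = x) ∧
      (∀ x ∈ S, ContDiffAt ℝ ∞ (ξ x) (0, t₀)) ∧
      (∀ x ∈ S, ∀ᶠ q in 𝓝 ((x, ((0 : ℝ), t₀)) : 𝔼² × (ℝ × ℝ)),
        d1 (F q.2.1) (q.2.2, q.1) = 0 → q.1 = ξ x q.2) ∧
      (∀ᶠ y in 𝓝 (((0 : ℝ), t₀) : ℝ × ℝ), ∀ x ∈ S,
        d1 (F y.1) (y.2, ξ x y) = 0 ∧ hessDet (F y.1) (y.2, ξ x y) ≠ 0) ∧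
      (∀ᶠ y in 𝓝 (((0 : ℝ), t₀) : ℝ × ℝ), ∀ x ∈ S, ∀ x' ∈ S, ξ x y = ξ x' y → x = x') ∧
      (∀ ρ > 0, ∀ᶠ y in 𝓝 (((0 : ℝ), t₀) : ℝ × ℝ), ∀ x' ∈ K, d1 (F y.1) (y.2, x') = 0 →
        (∃ x ∈ S, x' = ξ x y) ∨
        (∃ x ∈ K, d1 (F 0) (t₀, x) = 0 ∧ x ∉ S ∧ dist x' x < ρ)) := by
  classical
  -- continuations
  have hcont : ∀ x ∈ S, ∃ ξ : ℝ × ℝ → 𝔼², ξ (0, t₀) = x ∧ ContDiffAt ℝ ∞ ξ (0, t₀) ∧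
      (∀ᶠ y in 𝓝 ((0 : ℝ), t₀), d1 (F y.1) (y.2, ξ y) = 0) ∧
      (∀ᶠ q in 𝓝 ((x, ((0 : ℝ), t₀)) : 𝔼² × (ℝ × ℝ)),
        d1 (F q.2.1) (q.2.2, q.1) = 0 → q.1 = ξ q.2) := fun x hx =>
    exists_criticalPoint_continuation hF (hS x hx).2.1 (hS x hx).2.2
  choose! ξ hξ0 hξs hξc hξu using hcont
  refine ⟨ξ, hξ0, hξs, hξu, ?_, ?_, ?_⟩
  · -- criticality and nondegeneracy
    have h : ∀ x ∈ S, ∀ᶠ y in 𝓝 (((0 : ℝ), t₀) : ℝ × ℝ),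
        d1 (F y.1) (y.2, ξ x y) = 0 ∧ hessDet (F y.1) (y.2, ξ x y) ≠ 0 := by
      intro x hx
      refine (hξc x hx).and ?_
      have hc1 : ContinuousAt (fun y : ℝ × ℝ => hessDet (F y.1) (y.2, ξ x y)) (0, t₀) := by
        have h1 : ContinuousAt (fun y : ℝ × ℝ => ((y.1, (y.2, ξ x y)) : ℝ × (ℝ × 𝔼²))) (0, t₀) :=
          continuousAt_fst.prodMk (continuousAt_snd.prodMk (hξs x hx).continuousAt)
        have h2 := (contDiff_hessDet_member hF).continuous.continuousAt.comp h1
        exact h2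
      have hne : hessDet (F 0) (t₀, ξ x (0, t₀)) ≠ 0 := by
        rw [hξ0 x hx]; exact (hS x hx).2.2
      exact hc1.eventually_ne hne
    exact (Finset.eventually_all S).2 h |>.mono fun y hy x hx => hy x hx
  · -- pairwise distinctness
    have h : ∀ x ∈ S, ∀ x' ∈ S, x ≠ x' →
        ∀ᶠ y in 𝓝 (((0 : ℝ), t₀) : ℝ × ℝ), ξ x y ≠ ξ x' y := by
      intro x hx x' hx' hne
      have hc : ContinuousAt (fun y : ℝ × ℝ => ξ x y - ξ x' y) (0, t₀) :=
        (hξs x hx).continuousAt.sub (hξs x' hx').continuousAt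
      have hne0 : ξ x (0, t₀) - ξ x' (0, t₀) ≠ 0 := by
        rw [hξ0 x hx, hξ0 x' hx']; exact sub_ne_zero.2 hne
      filter_upwards [hc.eventually_ne hne0] with y hy
      exact fun h => hy (sub_eq_zero.2 h)
    have h' : ∀ x ∈ S, ∀ᶠ y in 𝓝 (((0 : ℝ), t₀) : ℝ × ℝ), ∀ x' ∈ S, ξ x y = ξ x' y → x = x' := by
      intro x hx
      have h'' : ∀ x' ∈ S, ∀ᶠ y in 𝓝 (((0 : ℝ), t₀) : ℝ × ℝ), ξ x y = ξ x' y → x = x' := by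
        intro x' hx'
        by_cases hxx : x = x'
        · exact Eventually.of_forall fun y _ => hxx
        · exact (h x hx x' hx' hxx).mono fun y hy heq => absurd heq hy
      exact (Finset.eventually_all S).2 h'' |>.mono fun y hy x' hx' => hy x' hx'
    exact (Finset.eventually_all S).2 h' |>.mono fun y hy x hx => hy x hx
  · -- every critical point in `K` is a continuation, or close to a critical point outside `S`
    intro ρ hρ
    have hrad : ∀ x ∈ S, ∃ r > 0, ∀ y : ℝ × ℝ, dist y (0, t₀) < r → ∀ x' : 𝔼², dist x' x < r →
        d1 (F y.1) (y.2, x') = 0 → x' = ξ x y := by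
      intro x hx
      obtain ⟨r, hr, hball⟩ := Metric.eventually_nhds_iff_ball.1 (hξu x hx)
      refine ⟨r, hr, fun y hy x' hx' hc => ?_⟩
      have hmem' : ((x', y) : 𝔼² × (ℝ × ℝ)) ∈ ball ((x, ((0 : ℝ), t₀)) : 𝔼² × (ℝ × ℝ)) r := by
        rw [mem_ball, Prod.dist_eq]; exact max_lt hx' hy
      exact hball _ hmem' hc
    choose! r hr hru using hrad
    -- a common radius, also below `ρ`
    obtain ⟨δ, hδ, hδr, hδρ⟩ : ∃ δ > 0, (∀ x ∈ S, δ ≤ r x) ∧ δ ≤ ρ := by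
      by_cases hSe : S = ∅
      · exact ⟨ρ, hρ, fun x hx => by simp [hSe] at hx, le_rfl⟩
      · have hne : S.Nonempty := Finset.nonempty_iff_ne_empty.2 hSe
        refine ⟨min (S.inf' hne r) ρ, ?_, fun x hx => (min_le_left _ _).trans (Finset.inf'_le _ hx),
          min_le_right _ _⟩
        obtain ⟨x, hx, hxeq⟩ := Finset.exists_mem_eq_inf' hne r
        rw [hxeq]; exact lt_min (hr x hx) hρ
    have hyδ : ∀ᶠ y in 𝓝 (((0 : ℝ), t₀) : ℝ × ℝ), dist y (0, t₀) < δ := ball_mem_nhds _ hδ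
    filter_upwards [eventually_forall_near_critical hF hK t₀ hδ, hyδ] with y hy hyd x' hx'K hc
    obtain ⟨x, hxK, hxc, hdist⟩ := hy x' hx'K hc
    by_cases hxS : x ∈ S
    · exact Or.inl ⟨x, hxS,
        hru x hxS y (hyd.trans_le (hδr x hxS)) x' (hdist.trans_le (hδr x hxS)) hc⟩
    · exact Or.inr ⟨x, hxK, hxc, hxS, hdist.trans_le hδρ⟩

/-- **Local structure of the critical set near a parameter value, nondegenerate case.**  If all
critical points in the compact set `K` of the slice `x ↦ F 0 (λ₀, x)` are nondegenerate, then
they form a finite set `S`, each `x ∈ S` continues to a function `ξ x (u, λ)`, smooth at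
`(0, λ₀)` with `ξ x (0, λ₀) = x`, and for `(u, λ)` near `(0, λ₀)`: the `ξ x (u, λ)` are
nondegenerate critical points of the slice, pairwise distinct, and every critical point of the
slice in `K` is one of them. [cite: CerfDiffeoSphere1968, Ch. II §2, Prop. 4] -/
theorem exists_local_continuations (hF : ContDiff ℝ ∞ fun p : ℝ × (ℝ × 𝔼²) => F p.1 p.2)
    {K : Set 𝔼²} (hK : IsCompact K) (t₀ : ℝ)
    (hnd : ∀ x ∈ K, d1 (F 0) (t₀, x) = 0 → hessDet (F 0) (t₀, x) ≠ 0) :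
    ∃ (S : Finset 𝔼²) (ξ : 𝔼² → ℝ × ℝ → 𝔼²),
      (∀ x, x ∈ S ↔ x ∈ K ∧ d1 (F 0) (t₀, x) = 0) ∧
      (∀ x ∈ S, ξ x (0, t₀) = x) ∧
      (∀ x ∈ S, ContDiffAt ℝ ∞ (ξ x) (0, t₀)) ∧
      (∀ x ∈ S, ∀ᶠ q in 𝓝 ((x, ((0 : ℝ), t₀)) : 𝔼² × (ℝ × ℝ)),
        d1 (F q.2.1) (q.2.2, q.1) = 0 → q.1 = ξ x q.2) ∧
      (∀ᶠ y in 𝓝 (((0 : ℝ), t₀) : ℝ × ℝ), ∀ x ∈ S,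
        d1 (F y.1) (y.2, ξ x y) = 0 ∧ hessDet (F y.1) (y.2, ξ x y) ≠ 0) ∧
      (∀ᶠ y in 𝓝 (((0 : ℝ), t₀) : ℝ × ℝ), ∀ x ∈ S, ∀ x' ∈ S, ξ x y = ξ x' y → x = x') ∧
      (∀ᶠ y in 𝓝 (((0 : ℝ), t₀) : ℝ × ℝ), ∀ x' ∈ K, d1 (F y.1) (y.2, x') = 0 →
        ∃ x ∈ S, x' = ξ x y) := by
  classical
  have hfin : {x ∈ K | d1 (F 0) (t₀, x) = 0}.Finite :=
    finite_criticalSet hF hK t₀ fun x hx hc => Or.inl (hnd x hx hc)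
  obtain ⟨S, hS⟩ : ∃ S : Finset 𝔼², S = hfin.toFinset := ⟨_, rfl⟩
  have hmem : ∀ x, x ∈ S ↔ x ∈ K ∧ d1 (F 0) (t₀, x) = 0 := fun x => by
    rw [hS, Set.Finite.mem_toFinset]; rfl
  obtain ⟨ξ, hξ0, hξs, hξn, hξc, hξi, hξu⟩ := exists_continuations_core hF hK t₀ S
    fun x hx => ⟨((hmem x).1 hx).1, ((hmem x).1 hx).2, hnd x ((hmem x).1 hx).1 ((hmem x).1 hx).2⟩
  refine ⟨S, ξ, hmem, hξ0, hξs, hξn, hξc, hξi, ?_⟩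
  filter_upwards [hξu 1 one_pos] with y hy x' hx' hc
  rcases hy x' hx' hc with h | ⟨x, hxK, hxc, hxS, -⟩
  · exact h
  · exact absurd ((hmem x).2 ⟨hxK, hxc⟩) hxS

/-- **Local structure of the critical set near a parameter value, birth–death case.**  If the
slice `x ↦ F 0 (λ₀, x)` has a generic birth–death point `x₀` (Cerf's Déf. 1: `p = q = δ = 0`,
second jet `≠ 0`, `(λ, x, y) ↦ (p, q, δ)` submersive) and all its other critical points in the
compact set `K` are nondegenerate, then these other points form a finite set `S` with smooth
continuations `ξ x (u, λ)` which, for `(u, λ)` near `(0, λ₀)`, are nondegenerate critical points,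
pairwise distinct and bounded away from `x₀`; and for every `ρ > 0`, eventually every critical
point of the slice in `K` is one of them or lies within `ρ` of `x₀` (where the birth–death
chart `CerfBirthDeathCurve.exists_birthDeath_chart` describes it).
[cite: CerfDiffeoSphere1968, Ch. II §2, 2°–3° and Prop. 4] -/
theorem exists_local_continuations_birthDeath
    (hF : ContDiff ℝ ∞ fun p : ℝ × (ℝ × 𝔼²) => F p.1 p.2)
    {K : Set 𝔼²} (hK : IsCompact K) {t₀ : ℝ} {x₀ : 𝔼²}
    (hcrit : d1 (F 0) (t₀, x₀) = 0) (hdeg : hessDet (F 0) (t₀, x₀) = 0)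
    (hjet : jet2 (F 0) (t₀, x₀) ≠ 0)
    (hcorr : Surjective (fderiv ℝ (fun z => (d1 (F 0) z, hessDet (F 0) z)) (t₀, x₀)))
    (hnd : ∀ x ∈ K, d1 (F 0) (t₀, x) = 0 → x ≠ x₀ → hessDet (F 0) (t₀, x) ≠ 0) :
    ∃ (S : Finset 𝔼²) (ξ : 𝔼² → ℝ × ℝ → 𝔼²),
      (∀ x, x ∈ S ↔ x ∈ K ∧ d1 (F 0) (t₀, x) = 0 ∧ x ≠ x₀) ∧
      (∀ x ∈ S, ξ x (0, t₀) = x) ∧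
      (∀ x ∈ S, ContDiffAt ℝ ∞ (ξ x) (0, t₀)) ∧
      (∀ x ∈ S, ∀ᶠ q in 𝓝 ((x, ((0 : ℝ), t₀)) : 𝔼² × (ℝ × ℝ)),
        d1 (F q.2.1) (q.2.2, q.1) = 0 → q.1 = ξ x q.2) ∧
      (∀ᶠ y in 𝓝 (((0 : ℝ), t₀) : ℝ × ℝ), ∀ x ∈ S,
        d1 (F y.1) (y.2, ξ x y) = 0 ∧ hessDet (F y.1) (y.2, ξ x y) ≠ 0) ∧
      (∀ᶠ y in 𝓝 (((0 : ℝ), t₀) : ℝ × ℝ), ∀ x ∈ S, ∀ x' ∈ S, ξ x y = ξ x' y → x = x') ∧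
      (∃ ρ₀ > 0, ∀ᶠ y in 𝓝 (((0 : ℝ), t₀) : ℝ × ℝ), ∀ x ∈ S, ρ₀ ≤ dist (ξ x y) x₀) ∧
      (∀ ρ > 0, ∀ᶠ y in 𝓝 (((0 : ℝ), t₀) : ℝ × ℝ), ∀ x' ∈ K, d1 (F y.1) (y.2, x') = 0 →
        (∃ x ∈ S, x' = ξ x y) ∨ dist x' x₀ < ρ) := by
  classical
  have hfin : {x ∈ K | d1 (F 0) (t₀, x) = 0}.Finite := by
    refine finite_criticalSet hF hK t₀ fun x hx hc => ?_
    by_cases hxx : x = x₀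
    · subst hxx; exact Or.inr ⟨hjet, hcorr⟩
    · exact Or.inl (hnd x hx hc hxx)
  obtain ⟨S, hS⟩ : ∃ S : Finset 𝔼², S = hfin.toFinset.erase x₀ := ⟨_, rfl⟩
  have hmem : ∀ x, x ∈ S ↔ x ∈ K ∧ d1 (F 0) (t₀, x) = 0 ∧ x ≠ x₀ := fun x => by
    rw [hS, Finset.mem_erase, Set.Finite.mem_toFinset]
    simp only [mem_setOf_eq]
    tauto
  obtain ⟨ξ, hξ0, hξs, hξn, hξc, hξi, hξu⟩ := exists_continuations_core hF hK t₀ S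
    fun x hx => ⟨((hmem x).1 hx).1, ((hmem x).1 hx).2.1,
      hnd x ((hmem x).1 hx).1 ((hmem x).1 hx).2.1 ((hmem x).1 hx).2.2⟩
  refine ⟨S, ξ, hmem, hξ0, hξs, hξn, hξc, hξi, ?_, ?_⟩
  · -- the continuations stay away from `x₀`
    have h : ∀ x ∈ S, ∀ᶠ y in 𝓝 (((0 : ℝ), t₀) : ℝ × ℝ), dist x x₀ / 2 ≤ dist (ξ x y) x₀ := by
      intro x hx
      have hpos : 0 < dist x x₀ := dist_pos.2 ((hmem x).1 hx).2.2
      have hc : ContinuousAt (fun y : ℝ × ℝ => dist (ξ x y) x₀) (0, t₀) :=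
        (hξs x hx).continuousAt.dist continuousAt_const
      have hgt : dist x x₀ / 2 < dist (ξ x (0, t₀)) x₀ := by rw [hξ0 x hx]; linarith
      exact (hc.eventually (eventually_gt_nhds hgt)).mono fun y hy => hy.le
    by_cases hSe : S = ∅
    · exact ⟨1, one_pos, Eventually.of_forall fun y x hx => by simp [hSe] at hx⟩
    · have hne : S.Nonempty := Finset.nonempty_iff_ne_empty.2 hSe
      refine ⟨S.inf' hne fun x => dist x x₀ / 2, ?_, ?_⟩
      · obtain ⟨x, hx, hxeq⟩ := Finset.exists_mem_eq_inf' hne fun x => dist x x₀ / 2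
        rw [hxeq]
        exact half_pos (dist_pos.2 ((hmem x).1 hx).2.2)
      · exact (Finset.eventually_all S).2 h |>.mono fun y hy x hx =>
          (Finset.inf'_le _ hx).trans (hy x hx)
  · intro ρ hρ
    filter_upwards [hξu ρ hρ] with y hy x' hx' hc
    rcases hy x' hx' hc with h | ⟨x, hxK, hxc, hxS, hdist⟩
    · exact Or.inl h
    · right
      have hx0 : x = x₀ := by
        by_contra hne
        exact hxS ((hmem x).2 ⟨hxK, hxc, hne⟩)
      rwa [hx0] at hdist

end CerfPath

end Literature.Topology.FourManifolds
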